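import Summits.KontsevichZagierPeriods.KontsevichZagierPeriods.Theorems.UnfoldedStokesDefs
import Summits.KontsevichZagierPeriods.KontsevichZagierPeriods.Theorems.FibrewiseStokesGenerationConjecture
import Summits.KontsevichZagierPeriods.KontsevichZagierPeriods.Theorems.UnfoldedStokesStokesGenerationFibrewiseRungRelations
import Summits.KontsevichZagierPeriods.KontsevichZagierPeriods.Theorems.UnfoldedStokesStokesGenerationFibrewiseRungAngularSector
import Summits.KontsevichZagierPeriods.KontsevichZagierPeriods.Theorems.UnfoldedStokesStokesGenerationFibrewiseRungTransport
import Summits.KontsevichZagierPeriods.KontsevichZagierPeriods.Theorems.UnfoldedStokesStokesGenerationFibrewiseRungDlogSwap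

/-!
# `StokesGeneration` (stmt-KontsevichZagierPeriods-3586), line `fibrewise_stokes` — the S2 class `FibStokesDecomposable`: dictionary

With the route definition `FibStokesDecomposable M h` (`Theorems/UnfoldedStokesDefs.lean`) every statement of the line
becomes one line. This file is the DICTIONARY between the definition and what is already in the tree (all by
definitional unfolding — no mathematics is added, nothing is restated with a new proof):
* the residual S2 `FibrewiseStokesGenerationConjecture` (p123182) says exactly: every bounded closed-cube representation
  of value `0` has a fibrewise-Stokes decomposable integrand (`fibrewiseStokesGenerationConjecture_iff_decomposable`);
* the landed bridge `of_mem_relations_of_fibStokesDecomposition` (p126386) says: a closed-cube representation with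
  decomposable integrand is a Kontsevich–Zagier relation (`of_mem_relations_of_fibStokesDecomposable`) — so S2 is the
  statement "value `0` ⇒ decomposable" and the crux follows from it;
* the unconditional sectors of the line read: Baker sector (rung 1, p125207), dlog sector (rung 2, p126066), angular
  loops (rung 3, p126092), the full angular sector (rung 4, p128548), the rule-(2) relators of the interval (rung 2′,
  p128276) and the dlog transposition on the square (rung 6, p128879) all produce `FibStokesDecomposable _ t.integrand`.

References: J. Ayoub, Ann. of Math. 181 (2015), Conj. 1.1, Rem. 1.5; M. Kontsevich, D. Zagier, *Periods* (2001), §1.2.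
-/

noncomputable section

set_option linter.dupNamespace false

namespace Summit.KontsevichZagierPeriods.KontsevichZagierPeriods.Cruxes.StokesGeneration.FibrewiseStokes

open MeasureTheory Set
open Literature.NumberTheory.Transcendental
open Literature.NumberTheory.Transcendental.KZ
open Literature.ModelTheory.ExponentialFields (IsSemialgebraic)
open Summit.KontsevichZagierPeriods.KontsevichZagierPeriods (FibrewiseStokesGenerationConjecture)

/-- **The residual S2 in one line**: `FibrewiseStokesGenerationConjecture` says that every bounded closed-cube
representation of value `0` has a fibrewise-Stokes decomposable integrand (definitional unfolding).
[cite: Ayoub2015, Conj. 1.1 (transposed; our variant)] -/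
theorem fibrewiseStokesGenerationConjecture_iff_decomposable :
    FibrewiseStokesGenerationConjecture ↔
      ∀ (M : ℕ) (t : IntegralRep M), t.domain = Set.pi Set.univ (fun _ : Fin M => Set.Icc (0:ℝ) 1) →
        (∃ B : ℝ, ∀ z ∈ t.domain, |t.integrand z| ≤ B) → t.value = 0 → FibStokesDecomposable M t.integrand :=
  Iff.rfl

/-- **A closed-cube representation with fibrewise-Stokes decomposable integrand is a relation** (the landed bridge
`of_mem_relations_of_fibStokesDecomposition` — lift by slabs, excise the null set, calibrate each element — read through
the definition). Registered stub of this dictionary file. [cite: KontsevichZagier2001, §1.2 Conjecture 1] -/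
theorem of_mem_relations_of_fibStokesDecomposable : ∀ (M : ℕ) (t : IntegralRep M), t.domain = Set.pi Set.univ (fun _ : Fin M => Set.Icc (0:ℝ) 1) → FibStokesDecomposable M t.integrand → of t ∈ relations :=
  fun M t ht hdec => of_mem_relations_of_fibStokesDecomposition M t ht hdec

/-- **S2 implies the crux**, read through the definition: if every bounded closed-cube representation of value `0`
has a decomposable integrand then `StokesGeneration` holds (the landed bridge
`stokesGeneration_of_fibrewiseStokesGenerationConjecture`). [cite: KontsevichZagier2001, §1.2 Conjecture 1] -/
theorem stokesGeneration_of_forall_fibStokesDecomposable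
    (h : ∀ (M : ℕ) (t : IntegralRep M), t.domain = Set.pi Set.univ (fun _ : Fin M => Set.Icc (0:ℝ) 1) →
      (∃ B : ℝ, ∀ z ∈ t.domain, |t.integrand z| ≤ B) → t.value = 0 → FibStokesDecomposable M t.integrand) :
    Summit.KontsevichZagierPeriods.KontsevichZagierPeriods.Theses.UnfoldedStokes.StokesGeneration :=
  stokesGeneration_of_fibrewiseStokesGenerationConjecture (fibrewiseStokesGenerationConjecture_iff_decomposable.mpr h)

/-! ## The unconditional sectors, in one line each -/

/-- Rung 4 (the full angular sector, p128548) through the definition: the angular derivative `γ·Im(P′/P)` of a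
zero-free complex polynomial loop with real algebraic coefficients and value `0` is fibrewise-Stokes decomposable.
[cite: KontsevichZagier2001, §1.2] -/
theorem fibStokesDecomposable_angularSector (γ : ℝ) (A B : Polynomial ℝ) (hγ : IsAlgebraic ℚ γ)
    (hA : ∀ n, IsAlgebraic ℚ (A.coeff n)) (hB : ∀ n, IsAlgebraic ℚ (B.coeff n))
    (hAB : ∀ u ∈ Set.Icc (0:ℝ) 1, A.eval u ^ 2 + B.eval u ^ 2 ≠ 0) (t : IntegralRep 1)
    (ht : t.domain = Set.pi Set.univ (fun _ : Fin 1 => Set.Icc (0:ℝ) 1))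
    (hti : ∀ z ∈ Set.pi Set.univ (fun _ : Fin 1 => Set.Icc (0:ℝ) 1), t.integrand z =
      γ * ((A.eval (z 0) * (Polynomial.derivative B).eval (z 0) -
        (Polynomial.derivative A).eval (z 0) * B.eval (z 0)) / (A.eval (z 0) ^ 2 + B.eval (z 0) ^ 2)))
    (hv : t.value = 0) : FibStokesDecomposable 1 t.integrand :=
  fibrewiseStokesGeneration_angularSector γ A B hγ hA hB hAB t ht hti hv

/-- Rung 2′ (the rule-(2) relators of the interval, p128276) through the definition. [cite: KontsevichZagier2001, §1.2 rule (2)] -/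
theorem fibStokesDecomposable_transport (f f' φ φ' : ℝ → ℝ)
    (hf : IsSemialgebraicFunOn ℚ (Set.pi Set.univ (fun _ : Fin 1 => Set.Icc (0:ℝ) 1)) (fun z => f (z 0)))
    (hf' : IsSemialgebraicFunOn ℚ (Set.pi Set.univ (fun _ : Fin 1 => Set.Icc (0:ℝ) 1)) (fun z => f' (z 0)))
    (hφ : IsSemialgebraicFunOn ℚ (Set.pi Set.univ (fun _ : Fin 1 => Set.Icc (0:ℝ) 1)) (fun z => φ (z 0)))
    (hφ' : IsSemialgebraicFunOn ℚ (Set.pi Set.univ (fun _ : Fin 1 => Set.Icc (0:ℝ) 1)) (fun z => φ' (z 0)))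
    (hfc : ContinuousOn f (Set.Icc (0:ℝ) 1)) (hf'c : ContinuousOn f' (Set.Icc (0:ℝ) 1))
    (hφc : ContinuousOn φ (Set.Icc (0:ℝ) 1)) (hφ'c : ContinuousOn φ' (Set.Icc (0:ℝ) 1))
    (hfd : ∀ u ∈ Set.Ioo (0:ℝ) 1, HasDerivAt f (f' u) u) (hφd : ∀ u ∈ Set.Ioo (0:ℝ) 1, HasDerivAt φ (φ' u) u)
    (hφ0 : φ 0 = 0) (hφ1 : φ 1 = 1) (hφI : ∀ u ∈ Set.Icc (0:ℝ) 1, φ u ∈ Set.Icc (0:ℝ) 1)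
    (hφo : ∀ u ∈ Set.Ioo (0:ℝ) 1, φ u ∈ Set.Ioo (0:ℝ) 1) (t : IntegralRep 1)
    (ht : t.domain = Set.pi Set.univ (fun _ : Fin 1 => Set.Icc (0:ℝ) 1))
    (hti : ∀ z ∈ Set.pi Set.univ (fun _ : Fin 1 => Set.Icc (0:ℝ) 1), t.integrand z = f (z 0) - f (φ (z 0)) * φ' (z 0)) :
    FibStokesDecomposable 1 t.integrand :=
  fibrewiseStokesGeneration_transport f f' φ φ' hf hf' hφ hφ' hfc hf'c hφc hφ'c hfd hφd hφ0 hφ1 hφI hφo t ht hti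

/-- Rung 6 (the dlog transposition sector on the square, p128879) through the definition — a genuinely two-dimensional,
Baker-free sector. [cite: KontsevichZagier2001, §1.2 rule (2)] -/
theorem fibStokesDecomposable_dlogSwap (γ : ℝ) (p q : Polynomial ℝ) (hγ : IsAlgebraic ℚ γ)
    (hp : ∀ n, IsAlgebraic ℚ (p.coeff n)) (hq : ∀ n, IsAlgebraic ℚ (q.coeff n))
    (hppos : ∀ u ∈ Set.Icc (0:ℝ) 1, 0 < p.eval u) (hqpos : ∀ u ∈ Set.Icc (0:ℝ) 1, 0 < q.eval u)
    (hrel : p.eval 1 * q.eval 0 = p.eval 0 * q.eval 1) (t : IntegralRep 2)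
    (ht : t.domain = Set.pi Set.univ (fun _ : Fin 2 => Set.Icc (0:ℝ) 1))
    (hti : ∀ z ∈ Set.pi Set.univ (fun _ : Fin 2 => Set.Icc (0:ℝ) 1), t.integrand z =
      γ * ((Polynomial.derivative p).eval (z 0) / p.eval (z 0) -
        (Polynomial.derivative q).eval (z 1) / q.eval (z 1))) : FibStokesDecomposable 2 t.integrand :=
  fibrewiseStokesGeneration_dlogSwap γ p q hγ hp hq hppos hqpos hrel t ht hti

/-- Rung 1 (the Baker sector, p125207) through the definition: simple real algebraic poles off `[0,1]` with value `0`.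
[cite: Baker1975, Thm 2.1] -/
theorem fibStokesDecomposable_simpleRealPoles (s : ℕ) (a c : Fin s → ℝ) (ha : ∀ i, IsAlgebraic ℚ (a i))
    (hc : ∀ i, IsAlgebraic ℚ (c i)) (hout : ∀ i, a i < 0 ∨ 1 < a i) (t : IntegralRep 1)
    (ht : t.domain = Set.pi Set.univ (fun _ : Fin 1 => Set.Icc (0:ℝ) 1))
    (hti : ∀ z ∈ Set.pi Set.univ (fun _ : Fin 1 => Set.Icc (0:ℝ) 1), t.integrand z = ∑ i, c i / (z 0 - a i))
    (hv : t.value = 0) : FibStokesDecomposable 1 t.integrand :=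
  fibrewiseStokesGeneration_simpleRealPoles s a c ha hc hout t ht hti hv

end Summit.KontsevichZagierPeriods.KontsevichZagierPeriods.Cruxes.StokesGeneration.FibrewiseStokes

end
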